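import Summits.ResolutionOfSingularities.ResolutionOfSingularities.Theorems.TauChainLaw2
import Summits.ResolutionOfSingularities.ResolutionOfSingularities.Theorems.SurfacePortCells
import HarnessLib

/-!
# TauChainCutCells — decomp-res node «TauChainCut» (lens-4 g32 REV 2, critic row 186 CLEARED DECIDED +1 · MAP 0),
tree file 3/5 of the node

Content VERBATIM from the decomp-res lens-4 g32 node REV 2 `HOME/decomp-res-lens-4/g32/TauChainCut_rev2.lean` (pin
d70c0cc0; imports the landed tree only, carries nothing); HOME = run/shared/lean/pub/decomp-res; critic row 186
CLEARED DECIDED +1 · MAP 0; landing orders INBOX :984/:996 — provenance, critic text and the lens header in full in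
the first file of the node, `TauChainLaw`.  Namespace `…Theorems.HugValuationCut`; `--supports
stmt-ResolutionOfSingularities-28338`.

## This file

§95 (THE FIRST TWO CUTS, `section TauCells`): the g31 located residual = the STEEP-THREEFOLD cell (DECIDED · EMPTY
in kernel by Law A) ∧ the principal-threefold NON-SURFACE cell (DECIDED modulo the g31 port:
`noTowerWild_principalThreefold_of_port`) ∧ the rest; §97 (THE THIRD CUT, `section CurveCells` MINUS the four `h71`
corollaries): the non-hypersurface class = the CURVE-LIKE-THREEFOLD cell (DECIDED · EMPTY in kernel by Law C) ∧ the
MIXED residual **`NoWildMixedWallFreeFreshJumpShallowCompanionKangarooTowers`** (THE NEW LOCATED RESIDUAL of the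
lens-4 column — a marked point of ring dimension ≥ 4, or ring dimension 3 with τ ≡ 1, rational plane cone,
NON-PRINCIPAL root and a divisorial component of V(𝓘ᵢ) at some stage, `mixed_letters_of_residual`; the route aside's
HOME is this file, cone-free), the hypothesis-free `…_iff_g32` / up-link `…_of_aside` and the re-location `…_iff_g32
(h640 : SurfaceChainPort)` family; §98 (ENTRANCE CERTIFICATES, `section TauEntrances`): kernel-checked chart
identities of the finite profiles quoted in the cells' docstrings.  (This first part carries: `SteepThreefold`,
`WildSteepThreefoldWallFreeFreshJumpShallowCompanionKangarooTowersTerminate`,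
`WildPrincipalThreefoldNonSurfaceWallFreeFreshJumpShallowCompanionKangarooTowersTerminate`,
`WildNonHypersurfaceWallFreeFreshJumpShallowCompanionKangarooTowersTerminate`, `noTowerWild_split_steep`,
`noTowerWild_split_principalThreefold`, `noTowerWild_steepThreefold`,
`noTowerWild_principalThreefold_of_nonSurface_nonSteep`, `noTowerWild_principalThreefold_of_port`,
`wildSteepThreefoldWallFree_holds`, `wildPrincipalThreefoldNonSurfaceWallFree_holds`,
`wildNonSurfaceWallFreeFreshJumpShallow_split_g32`, `wildNonSurfaceWallFreeFreshJumpShallow_iff_nonHypersurface`,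
`tauOne_planeCone_of_nonHypersurface`,
`WildCurveLikeThreefoldWallFreeFreshJumpShallowCompanionKangarooTowersTerminate`,
`WildMixedWallFreeFreshJumpShallowCompanionKangarooTowersTerminate`, `noTowerWild_split_curveLike`,
`noTowerWild_curveLikeThreefold`, `wildCurveLikeThreefoldWallFree_holds`,
`wildNonHypersurfaceWallFreeFreshJumpShallow_split`, `wildNonSurfaceWallFreeFreshJumpShallow_split_cells`,
`wildNonSurfaceWallFreeFreshJumpShallow_iff_g32`, `wildWallFreeFreshJumpShallow_iff_g32`,
`mixed_letters_of_residual`, `NoWildSteepThreefoldTowers`, `NoWildPrincipalThreefoldNonSurfaceTowers`,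
`NoWildCurveLikeThreefoldTowers`.)

[WRITER NOTE (decomp-res writer g12): file split only (tree files ≤ 400 lines); namespace, sections, section
variables / opens and every declaration exactly as in the lens (the node's global dupNamespace-linter line is
dropped — the library sets it; the `open …Theses` line lives only in the Theses-cone file
`MaxContactCutTauChainCut`; the lens's cone imports `MaxContactCutSatelliteCut` / `MaxContactCutWallCutCells` /
`MaxContactCutSurfacePort` are confined to the cone file, the cone-free files import `SurfacePort` /
`SurfacePortCells` (⊇ the Wall / History / Depth cut cells they open) per rider (1)–(2)).]

(Sources: Hironaka1964 Ch. III (τ, directrix); Hironaka1970 / Giraud1975 (near points, τ-monotonicity);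
CossartJannsenSaito2020 Thm. 6.40, Def. 6.38–6.39, Thm. 6.35 / Cor. 6.37, Ch. 8; Hauser2010Kangaroo;
HauserPerlega2019 §2; CossartPiltant2008 §2; CossartPiltant2019; Hironaka2005; Matsumura1987 §28; StacksProject 0804
/ 0BIQ / 031I.)
-/

noncomputable section

open CategoryTheory AlgebraicGeometry IsLocalRing TopologicalSpace
open Literature.AlgebraicGeometry.Resolution
open Summit.ResolutionOfSingularities.ResolutionOfSingularities.Theorems
open WeakOrderReduction ForcedTowerClasses DivergentTowerClasses MonomialTowerClasses
open HugDimensionClasses HugDimensionKernels SurfaceShadowClasses SurfaceShadowKernels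
open NearPointCut (SingularClass)
open Scheme.IdealSheafData (vanishingIdeal)
open scoped BigOperators

namespace Summit.ResolutionOfSingularities.ResolutionOfSingularities.Theorems.HugValuationCut

section TauCells

variable {k : Type} [Field k]

/-! ## §95 (g32 · THE FIRST TWO CUTS) the g31 located residual = the STEEP-THREEFOLD cell (DECIDED · EMPTY in
kernel, Law A) ∧ — inside
its complement — the PRINCIPAL-THREEFOLD cell (DECIDED · EMPTY in kernel: `τ ≡ 1` ⇒ plane cone ⇒ surface column,
which the g31 residual
negates) ∧ the NON-HYPERSURFACE class (INTERMEDIATE, cut again in §97) — two successive `noTowerWild_split`s, each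
exact.  With g31's
surface cell this CLOSES THE ENTIRE PRINCIPAL-ROOT RING-DIMENSION-3 COLUMN of the wild contact-free off-locus aside
(surface sub-column
`e = 2`: g31, mod port; steep sub-column `e ≤ 1` — imperfect residue fields, composite weights, `e = 0`: g32, in kernel). -/

/-- **`SteepThreefold n T` — THE FIRST CUT LETTER**: ring dimension 3 at every marked point AND some marked point with `τ ≠ 1`
(`e ≤ 1`: the tangent cone is NOT an `n`-fold plane over `κ`, e.g. `in₂ = Z² + tX²` over `𝔽₂(t)`, `in₄ = (XU)²`, or `e = 0`). -/
def SteepThreefold (n : ℕ) (T : ForcedTower) : Prop :=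
  ThreefoldTower T ∧ ¬ TauOneTower n T

/-- **CELL 1 (g31 residual ∧ STEEP THREEFOLD)** — DECIDED: EMPTY by LAW A (`noTower_threefold_not_tauOne`, kernel, every `p`).
Wild, off-locus singular class, `p`-power forms, kangaroo-recurrent, companion-recurrent, shallow, fresh-jumping at
prime weight,
wall-free at weight 2, non-surface, AND: ring dimension 3 at every marked point with `τ(x_i) ≠ 1` at some stage.  ENTRANCES (the
configuration of the law OCCURS in the class and the profile is SEEN TO DIE): (R′3) of NODE-g31, `p = 2`, IMPERFECT
residue field:
`f = z² + t·x² + u⁷` over `K = 𝔽₂(t)` at the origin of `𝔸³_K` — principal, rd 3, `in₂ = Z² + tX²` is a `2`-power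
form with `τ = 2`
(`Z² + tX²` is not a power of one `K`-rational linear form since `t ∉ K²`; directrix `⟨Z, X⟩`), `{ord ≥ 2} = V(z, x,
u⁶) = {0}` isolated;
its unique near point is the origin of the `u`-chart, `z² + t·x² + u⁵` (`tau_entrance_imperfect_chart`), again `τ = 2`, then
`z² + t·x² + u³`, then `z² + t·x² + u` of order 1: the chain of `τ = 2` near points STOPS after two steps, as Law A demands (an
infinite one is impossible); (R′3′) COMPOSITE weight `n = 4`, `p = 2`: `f = x²u² + z⁵ + x⁷ + u⁷` over `𝔽₂` — `in₄ =
(XU)²`, `τ = 2`,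
isolated, `u`-chart total transform `u⁴·(x² + z⁵u + x⁷u³ + u³)` (`tau_entrance_composite_chart`) of order `2 < 4`
everywhere on the
exceptional divisor: NO near point — dead at once; (E0) `τ = 3` (`e = 0`, e.g. `in₂ = X² + tY² + sZ²` over
`𝔽₂(s,t)`): no near point
(`IsBlowup.not_isNear_of_stalkTau_eq_three`), dead at once.  No census bed lies here (all census beds are over the
perfect field `𝔽₂` at
prime weight: `τ = 1` automatic, NODE-g31 (E1)). -/
def WildSteepThreefoldWallFreeFreshJumpShallowCompanionKangarooTowersTerminate (n : ℕ) : Prop :=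
  NoTowerWild n fun T =>
    ((((((((SingularClass T ∧ Nonempty (MarkedShadow T n)) ∧ PPowerTower n T) ∧ ¬ EventuallyJumpFree n T) ∧
      ¬ EventuallyCompanionJumpFree n T) ∧ ¬ DeepTower n T) ∧ ¬ (n.Prime ∧ OldComponentJumpTower n T)) ∧
      ¬ (n = 2 ∧ WalledTower T)) ∧ ¬ SurfaceColumn n T) ∧ SteepThreefold n T

/-- **CELL 2 (g31 residual ∧ ¬ steep ∧ PRINCIPAL THREEFOLD)** — DECIDED: EMPTY in kernel (LAW A + KERNEL B + pure logic): a
non-steep threefold tower has `τ ≡ 1`, hence (`planeConeTower_of_tauOneTower`) a rational plane cone at every marked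
point, hence —
its root being principal — lies in g31's `SurfaceColumn`, which the g31 residual NEGATES.  Together with CELL 1 and
g31's surface cell
this CLOSES THE ENTIRE PRINCIPAL-ROOT RING-DIMENSION-3 COLUMN of the aside (all residue fields, all weights `n =
p·m`, `e = 2, 1, 0`).
ENTRANCES: none beyond those of CELL 1 and NODE-g31 (E1)/(E2) — the cell is the set-theoretic difference «principal
∧ rd 3 ∧ ¬surface ∧
¬steep», shown EMPTY letter by letter; the recorded principal rd-3 profiles all sit in g31's surface cell (`τ = 1`)
or in CELL 1 (`τ = 2`). -/
def WildPrincipalThreefoldNonSurfaceWallFreeFreshJumpShallowCompanionKangarooTowersTerminate (n : ℕ) : Prop :=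
  NoTowerWild n fun T =>
    (((((((((SingularClass T ∧ Nonempty (MarkedShadow T n)) ∧ PPowerTower n T) ∧ ¬ EventuallyJumpFree n T) ∧
      ¬ EventuallyCompanionJumpFree n T) ∧ ¬ DeepTower n T) ∧ ¬ (n.Prime ∧ OldComponentJumpTower n T)) ∧
      ¬ (n = 2 ∧ WalledTower T)) ∧ ¬ SurfaceColumn n T) ∧ ¬ SteepThreefold n T) ∧ (PrincipalRoot T ∧ ThreefoldTower T)

/-- **CLASS 3 (g31 residual ∧ ¬ steep ∧ ¬(principal ∧ threefold)) · THE NON-HYPERSURFACE CLASS — INTERMEDIATE (cut again by the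
curve-like law in §97)**: wild, off-locus singular class, `p`-power form at every marked point, kangaroo-recurrent,
companion-recurrent,
shallow, fresh-jumping at prime weight, wall-free at weight 2, non-surface, NOT steep (ring dimension 3 everywhere ⇒
`τ(x_i) = 1` and a
RATIONAL PLANE CONE at EVERY marked point, `tauOne_planeCone_of_nonHypersurface`), and NOT a hypersurface point of a
threefold: the root
stalk ideal is NOT PRINCIPAL, or some marked point has ring dimension 4. -/
def WildNonHypersurfaceWallFreeFreshJumpShallowCompanionKangarooTowersTerminate (n : ℕ) : Prop :=
  NoTowerWild n fun T =>
    (((((((((SingularClass T ∧ Nonempty (MarkedShadow T n)) ∧ PPowerTower n T) ∧ ¬ EventuallyJumpFree n T) ∧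
      ¬ EventuallyCompanionJumpFree n T) ∧ ¬ DeepTower n T) ∧ ¬ (n.Prime ∧ OldComponentJumpTower n T)) ∧
      ¬ (n = 2 ∧ WalledTower T)) ∧ ¬ SurfaceColumn n T) ∧ ¬ SteepThreefold n T) ∧ ¬ (PrincipalRoot T ∧ ThreefoldTower T)

/-- **KERNEL (pure logic): every class splits EXACTLY by the steep-threefold letter.** [folklore] -/
theorem noTowerWild_split_steep {n : ℕ} (P : ForcedTower → Prop) :
    NoTowerWild n P ↔
      NoTowerWild n (fun T => P T ∧ SteepThreefold n T) ∧ NoTowerWild n (fun T => P T ∧ ¬ SteepThreefold n T) :=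
  noTowerWild_split _ _

/-- **KERNEL (pure logic): every class splits EXACTLY by «principal ∧ threefold».** [folklore] -/
theorem noTowerWild_split_principalThreefold {n : ℕ} (P : ForcedTower → Prop) :
    NoTowerWild n P ↔
      NoTowerWild n (fun T => P T ∧ (PrincipalRoot T ∧ ThreefoldTower T)) ∧
        NoTowerWild n (fun T => P T ∧ ¬ (PrincipalRoot T ∧ ThreefoldTower T)) :=
  noTowerWild_split _ _

/-- **DECIDED (KERNEL, Law A; every class `P`, every `n ≥ 1`, every `p`, every field): THE STEEP-THREEFOLD CUT OF ANY CLASS IS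
EMPTY.** [folklore] -/
theorem noTowerWild_steepThreefold {n : ℕ} (hn : 1 ≤ n) (P : ForcedTower → Prop) :
    NoTowerWild n fun T => P T ∧ SteepThreefold n T := by
  intro p hp hpn K _ _ T g hB hD hE hT
  exact noTower_threefold_not_tauOne hn P p hp K T g hB hD hE ⟨hT.1, hT.2.1, hT.2.2⟩

/-- **DECIDED (KERNEL, Law A + Kernel B; every `n ≥ 1`, `p`, field): THE PRINCIPAL-THREEFOLD CUT OF ANY NON-SURFACE
NON-STEEP CLASS
IS EMPTY** — `τ ≡ 1` ⇒ plane cone everywhere ⇒ `SurfaceColumn`. [folklore] -/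
theorem noTowerWild_principalThreefold_of_nonSurface_nonSteep {n : ℕ} (hn : 1 ≤ n) (P : ForcedTower → Prop) :
    NoTowerWild n fun T => ((P T ∧ ¬ SurfaceColumn n T) ∧ ¬ SteepThreefold n T) ∧ (PrincipalRoot T ∧ ThreefoldTower T) := by
  intro p hp hpn K _ _ T g hB hD hE hT
  obtain ⟨⟨⟨-, hns⟩, hsteep⟩, hprin, h3⟩ := hT
  have hτ : TauOneTower n T := by
    by_contra h
    exact hsteep ⟨h3, h⟩
  exact hns ⟨hprin, h3, Or.inl (planeConeTower_of_tauOneTower T g hB hn hD h3 hτ)⟩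

/-- **THE WHOLE PRINCIPAL-ROOT RING-DIMENSION-3 COLUMN OF ANY CLASS IS EMPTY, GIVEN THE PORT** (surface part: g31's bridge mod
`SurfaceChainPort`; the rest: kernel). [folklore] -/
theorem noTowerWild_principalThreefold_of_port (h640 : SurfaceChainPort) {n : ℕ} (hn : 1 ≤ n) (P : ForcedTower → Prop) :
    NoTowerWild n fun T => P T ∧ (PrincipalRoot T ∧ ThreefoldTower T) := by
  rw [noTowerWild_split_surface]
  refine ⟨noTowerWild_mono (fun T hT => ⟨hT.1.1, hT.2⟩) (noTowerWild_surfaceColumn_of_port h640 hn P), ?_⟩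
  rw [noTowerWild_split_steep]
  refine ⟨noTowerWild_mono (fun T hT => ⟨hT.1.1.1, hT.2⟩) (noTowerWild_steepThreefold hn P), ?_⟩
  exact noTowerWild_mono (fun T hT => ⟨⟨⟨hT.1.1.1, hT.1.2⟩, hT.2⟩, hT.1.1.2⟩)
    (noTowerWild_principalThreefold_of_nonSurface_nonSteep hn P)

/-- **CELL 1 IS EMPTY (KERNEL, every `n ≥ 1`).** [folklore] -/
theorem wildSteepThreefoldWallFree_holds {n : ℕ} (hn : 1 ≤ n) :
    WildSteepThreefoldWallFreeFreshJumpShallowCompanionKangarooTowersTerminate n :=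
  noTowerWild_steepThreefold hn _

/-- **CELL 2 IS EMPTY (KERNEL, every `n ≥ 1`).** [folklore] -/
theorem wildPrincipalThreefoldNonSurfaceWallFree_holds {n : ℕ} (hn : 1 ≤ n) :
    WildPrincipalThreefoldNonSurfaceWallFreeFreshJumpShallowCompanionKangarooTowersTerminate n :=
  noTowerWild_principalThreefold_of_nonSurface_nonSteep hn _

/-- **EXACT (pure logic): the g31 located residual = CELL 1 ∧ (CELL 2 ∧ CLASS 3).** [folklore] -/
theorem wildNonSurfaceWallFreeFreshJumpShallow_split_g32 (n : ℕ) :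
    WildNonSurfaceWallFreeFreshJumpShallowCompanionKangarooTowersTerminate n ↔
      WildSteepThreefoldWallFreeFreshJumpShallowCompanionKangarooTowersTerminate n ∧
        (WildPrincipalThreefoldNonSurfaceWallFreeFreshJumpShallowCompanionKangarooTowersTerminate n ∧
          WildNonHypersurfaceWallFreeFreshJumpShallowCompanionKangarooTowersTerminate n) :=
  (noTowerWild_split_steep _).trans (Iff.and Iff.rfl (noTowerWild_split_principalThreefold _))

/-- **EXACT RE-LOCATION, HYPOTHESIS-FREE (`n ≥ 1`): the g31 located residual ⟺ THE NON-HYPERSURFACE CLASS.** [folklore] -/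
theorem wildNonSurfaceWallFreeFreshJumpShallow_iff_nonHypersurface {n : ℕ} (hn : 1 ≤ n) :
    WildNonSurfaceWallFreeFreshJumpShallowCompanionKangarooTowersTerminate n ↔
      WildNonHypersurfaceWallFreeFreshJumpShallowCompanionKangarooTowersTerminate n :=
  ⟨fun h => ((wildNonSurfaceWallFreeFreshJumpShallow_split_g32 n).mp h).2.2,
    fun h => (wildNonSurfaceWallFreeFreshJumpShallow_split_g32 n).mpr
      ⟨wildSteepThreefoldWallFree_holds hn, wildPrincipalThreefoldNonSurfaceWallFree_holds hn, h⟩⟩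

/-- **THE LETTERS OF CLASS 3 ARE SHARP (KERNEL): a tower of the non-hypersurface class with ring dimension 3 at
every marked point has
`τ ≡ 1` AND a rational plane cone at every marked point AND a NON-PRINCIPAL root** (so CLASS 3 = (non-principal ∧ rd
3 ∧ `τ ≡ 1` ∧
plane cone) ∨ (some stage of ring dimension 4)). [folklore] -/
theorem tauOne_planeCone_of_nonHypersurface (T : ForcedTower) (g : T.St 0 ⟶ Spec (.of k)) (hB : IsBase (T.St 0) g) {n : ℕ}
    (hn : 1 ≤ n) (hD : IsDatum n (T.D 0)) {P : ForcedTower → Prop}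
    (hT : ((P T ∧ ¬ SurfaceColumn n T) ∧ ¬ SteepThreefold n T) ∧ ¬ (PrincipalRoot T ∧ ThreefoldTower T))
    (h3 : ThreefoldTower T) : TauOneTower n T ∧ PlaneConeTower n T ∧ ¬ PrincipalRoot T := by
  obtain ⟨⟨⟨-, hns⟩, hsteep⟩, hnp⟩ := hT
  have hτ : TauOneTower n T := by
    by_contra h
    exact hsteep ⟨h3, h⟩
  exact ⟨hτ, planeConeTower_of_tauOneTower T g hB hn hD h3 hτ, fun hprin => hnp ⟨hprin, h3⟩⟩

end TauCells

section CurveCells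

variable {k : Type} [Field k]

/-! ## §97 (g32 · THE THIRD CUT) the non-hypersurface class = the CURVE-LIKE-THREEFOLD cell (DECIDED · EMPTY in
kernel, Law C) ∧ the MIXED
residual (UNDECIDED) — exact by `noTowerWild_split`; re-locations BY NAME down the aside chain. -/

/-- **CELL 3a (non-hypersurface class ∧ CURVE-LIKE THREEFOLD)** — DECIDED: EMPTY by LAW C
(`noTower_threefold_curveLike`, kernel, every
`p`).  Wild, off-locus singular class, `p`-power forms, kangaroo-recurrent, companion-recurrent, shallow,
fresh-jumping at prime weight,
wall-free at weight 2, non-surface, non-steep (`τ ≡ 1`), not a threefold hypersurface point, AND: ring dimension 3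
at every marked point
with `V(𝓘_i)` of codimension `≥ 2` at every stage.  ENTRANCES (the configuration of the law OCCURS in the class):
(R′1) of NODE-g31 —
NON-PRINCIPAL, `p = 2`, rd 3, `τ = 1`: `𝓘 = (y² + x³ + u⁵, x⁴)` over `𝔽₂` at the origin of `𝔸³`: `V(𝓘) = V(x, y² + u⁵)` is an
irreducible CURVE (codimension 2: its generic point has coheight 2, its closed points 3), `in₂ 𝓘 = (Y²)` (`τ = 1`,
plane cone `Y`),
`{ord ≥ 2} = {0}` isolated, non-principal; `u`-chart controlled transform `(y² + x³u + u³, x⁴u²)` (g31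
`surface_entrance_nonprincipal_chart`)
with zero locus `V(u, y) ∪ V(x, y² + u³)` — again two curves, again order 2, `τ = 1`: the law (a proof by
contradiction through the formal
germ `V(ŷ)`, not an exhibited clock) says this chain of near points is FINITE.  No census bed lies here (the census
beds are hypersurfaces). -/
def WildCurveLikeThreefoldWallFreeFreshJumpShallowCompanionKangarooTowersTerminate (n : ℕ) : Prop :=
  NoTowerWild n fun T =>
    ((((((((((SingularClass T ∧ Nonempty (MarkedShadow T n)) ∧ PPowerTower n T) ∧ ¬ EventuallyJumpFree n T) ∧
      ¬ EventuallyCompanionJumpFree n T) ∧ ¬ DeepTower n T) ∧ ¬ (n.Prime ∧ OldComponentJumpTower n T)) ∧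
      ¬ (n = 2 ∧ WalledTower T)) ∧ ¬ SurfaceColumn n T) ∧ ¬ SteepThreefold n T) ∧ ¬ (PrincipalRoot T ∧ ThreefoldTower T)) ∧
      (ThreefoldTower T ∧ CurveLikeTower T)

/-- **CELL 3b (non-hypersurface class ∧ ¬(curve-like threefold)) · THE LOCATED RESIDUAL after g32 — THE MIXED
RESIDUAL** — UNDECIDED ·
IDEA-NEEDED: wild, off-locus singular class, `p`-power form at every marked point, kangaroo-recurrent,
companion-recurrent, shallow,
fresh-jumping at prime weight, wall-free at weight 2, non-surface, non-steep, not a threefold hypersurface point,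
and NOT a curve-like
threefold tower; i.e. (`mixed_letters_of_residual`) EITHER some marked point has ring dimension 4, OR ring dimension
3 at every marked
point — then `τ ≡ 1`, rational plane cone everywhere, NON-PRINCIPAL root — and at some stage the zero locus `V(𝓘_i)`
has a point of
codimension `≤ 1`: `𝓘_i` has a DIVISORIAL COMPONENT (a MIXED ideal `𝓘 = 𝓘(D)·𝓚`, neither a hypersurface nor a curve).  ENTRANCES
(single-stage profiles carrying the letters; no census bed lies here): (M1) MIXED, `p = 2`, rd 3, `τ = 1`: `𝓘 = (x²,
xy³, xu³) = x·(x, y³, u³)`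
over `𝔽₂` at the origin of `𝔸³` — order 2, `in₂ = (X²)` (a `2`-power form; plane cone `X`; `τ = 1`), NON-PRINCIPAL,
`V(𝓘) = V(x)` a
SURFACE (its generic point has coheight 1: not curve-like), `{ord ≥ 2} = {0}` ISOLATED (at a point of `V(x)` off the
origin `(x, y³, u³)`
is the unit ideal, `𝓘 = (x)` has order 1); `u`-chart: total transform `(x²u², xy³u⁴, xu⁴) = u²·(x², xy³u², xu²)`,
controlled transform
`𝓘₁ = x·(x, y³u², u²)` (`mixed_entrance_chart`) — again mixed of order 2 at the origin (a near point), divisorial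
part `V(x)` = the strict
transform of the surface; (R′2) of NODE-g31, RING DIMENSION 4: `z² + x³ + y³ + w³ ∈ 𝔽₂[x,y,z,w]` (principal,
`DimFourAt` at stage 0;
`x`-chart `z² + x(1 + y³ + w³)`, g31 `surface_entrance_fourfold_chart`).  Nearest printed laws: (M)
Cossart–Jannsen–Saito 2020 treat
ARBITRARY (non-reduced, non-equidimensional) excellent schemes of dimension two by the Hilbert–Samuel stratification
— the divisorial part
`D` is a boundary-like companion of the weak-transform calculus (NEXT-g33 (MX)); (R′2) nothing in print in ring
dimension 4 (rows 169/176: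
IDEA-NEEDED). -/
def WildMixedWallFreeFreshJumpShallowCompanionKangarooTowersTerminate (n : ℕ) : Prop :=
  NoTowerWild n fun T =>
    ((((((((((SingularClass T ∧ Nonempty (MarkedShadow T n)) ∧ PPowerTower n T) ∧ ¬ EventuallyJumpFree n T) ∧
      ¬ EventuallyCompanionJumpFree n T) ∧ ¬ DeepTower n T) ∧ ¬ (n.Prime ∧ OldComponentJumpTower n T)) ∧
      ¬ (n = 2 ∧ WalledTower T)) ∧ ¬ SurfaceColumn n T) ∧ ¬ SteepThreefold n T) ∧ ¬ (PrincipalRoot T ∧ ThreefoldTower T)) ∧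
      ¬ (ThreefoldTower T ∧ CurveLikeTower T)

/-- **KERNEL (pure logic): every class splits EXACTLY by «threefold ∧ curve-like».** [folklore] -/
theorem noTowerWild_split_curveLike {n : ℕ} (P : ForcedTower → Prop) :
    NoTowerWild n P ↔
      NoTowerWild n (fun T => P T ∧ (ThreefoldTower T ∧ CurveLikeTower T)) ∧
        NoTowerWild n (fun T => P T ∧ ¬ (ThreefoldTower T ∧ CurveLikeTower T)) :=
  noTowerWild_split _ _

/-- **DECIDED (KERNEL, Law C; every class `P`, every `n ≥ 1`, every `p`, every field): THE CURVE-LIKE-THREEFOLD CUT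
OF ANY CLASS IS
EMPTY.** [folklore] -/
theorem noTowerWild_curveLikeThreefold {n : ℕ} (hn : 1 ≤ n) (P : ForcedTower → Prop) :
    NoTowerWild n fun T => P T ∧ (ThreefoldTower T ∧ CurveLikeTower T) :=
  noTowerWild_threefold_curveLike hn P

/-- **CELL 3a IS EMPTY (KERNEL, every `n ≥ 1`).** [folklore] -/
theorem wildCurveLikeThreefoldWallFree_holds {n : ℕ} (hn : 1 ≤ n) :
    WildCurveLikeThreefoldWallFreeFreshJumpShallowCompanionKangarooTowersTerminate n :=
  noTowerWild_curveLikeThreefold hn _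

/-- **EXACT (pure logic): the non-hypersurface class = CELL 3a ∧ CELL 3b.** [folklore] -/
theorem wildNonHypersurfaceWallFreeFreshJumpShallow_split (n : ℕ) :
    WildNonHypersurfaceWallFreeFreshJumpShallowCompanionKangarooTowersTerminate n ↔
      WildCurveLikeThreefoldWallFreeFreshJumpShallowCompanionKangarooTowersTerminate n ∧
        WildMixedWallFreeFreshJumpShallowCompanionKangarooTowersTerminate n :=
  noTowerWild_split _ _

/-- **EXACT (pure logic): the g31 located residual = CELL 1 ∧ CELL 2 ∧ CELL 3a ∧ CELL 3b.** [folklore] -/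
theorem wildNonSurfaceWallFreeFreshJumpShallow_split_cells (n : ℕ) :
    WildNonSurfaceWallFreeFreshJumpShallowCompanionKangarooTowersTerminate n ↔
      WildSteepThreefoldWallFreeFreshJumpShallowCompanionKangarooTowersTerminate n ∧
        (WildPrincipalThreefoldNonSurfaceWallFreeFreshJumpShallowCompanionKangarooTowersTerminate n ∧
          (WildCurveLikeThreefoldWallFreeFreshJumpShallowCompanionKangarooTowersTerminate n ∧
            WildMixedWallFreeFreshJumpShallowCompanionKangarooTowersTerminate n)) :=
  (wildNonSurfaceWallFreeFreshJumpShallow_split_g32 n).trans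
    (Iff.and Iff.rfl (Iff.and Iff.rfl (wildNonHypersurfaceWallFreeFreshJumpShallow_split n)))

/-- **EXACT RE-LOCATION, HYPOTHESIS-FREE (`n ≥ 1`): the g31 located residual ⟺ THE MIXED RESIDUAL.** [folklore] -/
theorem wildNonSurfaceWallFreeFreshJumpShallow_iff_g32 {n : ℕ} (hn : 1 ≤ n) :
    WildNonSurfaceWallFreeFreshJumpShallowCompanionKangarooTowersTerminate n ↔
      WildMixedWallFreeFreshJumpShallowCompanionKangarooTowersTerminate n :=
  ⟨fun h => ((wildNonSurfaceWallFreeFreshJumpShallow_split_cells n).mp h).2.2.2,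
    fun h => (wildNonSurfaceWallFreeFreshJumpShallow_split_cells n).mpr
      ⟨wildSteepThreefoldWallFree_holds hn, wildPrincipalThreefoldNonSurfaceWallFree_holds hn,
        wildCurveLikeThreefoldWallFree_holds hn, h⟩⟩

/-- **EXACT RE-LOCATION GIVEN THE PORT (`n ≥ 1`): the g30 located residual ⟺ the mixed residual.** [folklore] -/
theorem wildWallFreeFreshJumpShallow_iff_g32 (h640 : SurfaceChainPort) {n : ℕ} (hn : 1 ≤ n) :
    WildWallFreeFreshJumpShallowCompanionKangarooTowersTerminate n ↔
      WildMixedWallFreeFreshJumpShallowCompanionKangarooTowersTerminate n :=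
  (wildWallFreeFreshJumpShallow_iff_g31 h640 hn).trans (wildNonSurfaceWallFreeFreshJumpShallow_iff_g32 hn)

/-- **THE LETTERS OF THE MIXED RESIDUAL ARE SHARP (KERNEL + pure logic)**: a tower of the mixed residual class
EITHER has a marked point
of ring dimension `≠ 3`, OR has ring dimension 3 everywhere, `τ ≡ 1`, a rational plane cone at every marked point, a
NON-PRINCIPAL root,
and is NOT curve-like (some stage whose zero locus has a point of codimension `≤ 1`). [folklore] -/
theorem mixed_letters_of_residual (T : ForcedTower) (g : T.St 0 ⟶ Spec (.of k)) (hB : IsBase (T.St 0) g) {n : ℕ} (hn : 1 ≤ n)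
    (hD : IsDatum n (T.D 0)) {P : ForcedTower → Prop}
    (hT : (((P T ∧ ¬ SurfaceColumn n T) ∧ ¬ SteepThreefold n T) ∧ ¬ (PrincipalRoot T ∧ ThreefoldTower T)) ∧
      ¬ (ThreefoldTower T ∧ CurveLikeTower T)) :
    ¬ ThreefoldTower T ∨
      (ThreefoldTower T ∧ TauOneTower n T ∧ PlaneConeTower n T ∧ ¬ PrincipalRoot T ∧ ¬ CurveLikeTower T) := by
  by_cases h3 : ThreefoldTower T
  · obtain ⟨hτ, hcone, hnp⟩ := tauOne_planeCone_of_nonHypersurface T g hB hn hD hT.1 h3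
    exact Or.inr ⟨h3, hτ, hcone, hnp, fun hc => hT.2 ⟨h3, hc⟩⟩
  · exact Or.inl h3

/-- BY NAME: **no wild STEEP-THREEFOLD tower** (CELL 1; DECIDED in kernel). -/
def NoWildSteepThreefoldTowers : Prop :=
  ∀ n : ℕ, 1 ≤ n → WildSteepThreefoldWallFreeFreshJumpShallowCompanionKangarooTowersTerminate n

/-- BY NAME: **no wild PRINCIPAL-THREEFOLD non-surface tower** (CELL 2; DECIDED in kernel). -/
def NoWildPrincipalThreefoldNonSurfaceTowers : Prop :=
  ∀ n : ℕ, 1 ≤ n → WildPrincipalThreefoldNonSurfaceWallFreeFreshJumpShallowCompanionKangarooTowersTerminate n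

/-- BY NAME: **no wild CURVE-LIKE-THREEFOLD tower** (CELL 3a; DECIDED in kernel). -/
def NoWildCurveLikeThreefoldTowers : Prop :=
  ∀ n : ℕ, 1 ≤ n → WildCurveLikeThreefoldWallFreeFreshJumpShallowCompanionKangarooTowersTerminate n

end CurveCells

end Summit.ResolutionOfSingularities.ResolutionOfSingularities.Theorems.HugValuationCut
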